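import Mathlib
import Literature.NumberTheory.Automorphic.GaussCellGL

/-!
# Stub `stub_unipotent_translate_span` of line `Sketch` — crux `stmt-MatrixMultiplication-18360`
(`BorderHalfDimensionDesigns`, route `GLnSeparatingDesigns`)

The dimension count behind the refutation of the line's hardest stub `C⁺` (flag-minor hypersurface
designs): for a flag-minor monomial `f_μ(M) = Π_j Δ_{j+1}(M)^(q μ_j)` of weight `Σ μ_j ≤ d`, the
functions `M ↦ f_μ(u M)`, `u` upper UNItriangular, all lie in the `ℂ`-span of at most
`(qnd+1)^(n(n-1)/2)` fixed functions — the coefficient functions of the polynomial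
`u ↦ f_μ(u M)`, which has total degree `≤ q n d` in the `n(n-1)/2` free entries of `u`.
Here `Δ_a = Literature.NumberTheory.Automorphic.leadMinor Fin.castSucc · a` (leading principal minor
of size `a`).

Proof: generic unitriangular matrix `U` over `MvPolynomial σ ℂ`, `σ` = strictly upper positions
(local notation `SU[n]`, `genU[n]`); `P_M := Π_j Δ_{j+1}(U · M)^(q μ_j)` (local notation `tP[…]`)
has `totalDegree ≤ q n d` (entries of `U · M` have degree `≤ 1`, a determinant of such entries has
degree `≤` its size); evaluating at the entries of `u` gives `f_μ(u M) = Σ_β u^β · coeff_β P_M`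
with `β` ranging over exponent vectors bounded by `q n d`. No definitions are introduced (local
notation only).
-/

set_option linter.dupNamespace false

open scoped MatrixGroups BigOperators
open Matrix
open Literature.NumberTheory.Automorphic (leadMinor leadBlock leadMinor_map)

namespace Summit.MatrixMultiplication.MatrixMultiplication.Theorems.BorderHalfDimensionDesigns

section UnipotentSpan

-- strictly upper-triangular positions (local notation)
local notation3 "SU[" n "]" => {p : Fin n × Fin n // p.1 < p.2}

-- the generic upper unitriangular matrix over `ℂ[x_s : s strictly upper]` (local notation)
local notation3 "genU[" n "]" =>
  (Matrix.of fun i j : Fin n =>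
    if h : i < j then (MvPolynomial.X (⟨(i, j), h⟩ : SU[n]) : MvPolynomial SU[n] ℂ)
    else if i = j then 1 else 0)

-- a complex matrix as a matrix of constant polynomials (local notation)
local notation3 "cM[" n "," M "]" =>
  (Matrix.map M (⇑(MvPolynomial.C : ℂ →+* MvPolynomial SU[n] ℂ)))

-- the test polynomial `P_M = Π_j Δ_{j+1}(U · M)^(q μ_j)` (local notation)
local notation3 "tP[" n "," q "," μ "," M "]" =>
  (∏ j : Fin n, (leadMinor Fin.castSucc (genU[n] * cM[n, M]) (Fin.succ j)) ^ ((q : ℕ) * (μ : Fin n → ℕ) j))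

-- exponent vectors bounded by `K` as finitely supported functions (local notation)
local notation3 "toF[" β "]" => (Finsupp.equivFunOnFinite.symm (Fin.val ∘ β))

variable {n : ℕ}

/-- Entries of the generic unitriangular matrix have total degree `≤ 1`. -/
private theorem totalDegree_genU_le (i j : Fin n) : (genU[n] i j).totalDegree ≤ 1 := by
  simp only [Matrix.of_apply]
  split_ifs with h h'
  · exact (MvPolynomial.totalDegree_X _).le
  · simp
  · simp

/-- Entries of `U · M` (generic unitriangular `U`, constant `M`) have total degree `≤ 1`. -/
private theorem totalDegree_genU_mul_le (M : Matrix (Fin n) (Fin n) ℂ) (i j : Fin n) :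
    ((genU[n] * cM[n, M]) i j).totalDegree ≤ 1 := by
  rw [Matrix.mul_apply]
  refine (MvPolynomial.totalDegree_finsetSum _ _).trans (Finset.sup_le fun k _ => ?_)
  refine (MvPolynomial.totalDegree_mul _ _).trans ?_
  rw [Matrix.map_apply, MvPolynomial.totalDegree_C, add_zero]
  exact totalDegree_genU_le i k

/-- A determinant of entries of total degree `≤ 1` has total degree at most its size. -/
private theorem totalDegree_det_le {m : Type*} [Fintype m] [DecidableEq m] {τ : Type*}
    (B : Matrix m m (MvPolynomial τ ℂ)) (hB : ∀ i j, (B i j).totalDegree ≤ 1) :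
    B.det.totalDegree ≤ Fintype.card m := by
  rw [Matrix.det_apply']
  refine (MvPolynomial.totalDegree_finsetSum _ _).trans (Finset.sup_le fun π _ => ?_)
  refine (MvPolynomial.totalDegree_mul _ _).trans ?_
  have h1 : ((Equiv.Perm.sign π : ℤ) : MvPolynomial τ ℂ).totalDegree = 0 := by
    rw [← map_intCast (MvPolynomial.C : ℂ →+* MvPolynomial τ ℂ), MvPolynomial.totalDegree_C]
  rw [h1, zero_add]
  refine (MvPolynomial.totalDegree_finsetProd _ _).trans ?_
  calc ∑ i, (B (π i) i).totalDegree ≤ ∑ _i : m, 1 := Finset.sum_le_sum fun i _ => hB _ _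
    _ = Fintype.card m := by simp

/-- The leading minors of `U · M` have total degree `≤ n`. -/
private theorem totalDegree_leadMinor_genU_mul_le (M : Matrix (Fin n) (Fin n) ℂ) (a : Fin (n + 1)) :
    (leadMinor Fin.castSucc (genU[n] * cM[n, M]) a).totalDegree ≤ n := by
  unfold leadMinor leadBlock
  refine (totalDegree_det_le _ fun i j => ?_).trans ?_
  · exact totalDegree_genU_mul_le M _ _
  · exact (Fintype.card_subtype_le _).trans (by simp)

/-- `totalDegree P_M ≤ q n d` when `Σ μ_j ≤ d`. -/
private theorem totalDegree_testPoly_le (q d : ℕ) (μ : Fin n → ℕ) (hμ : ∑ j, μ j ≤ d)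
    (M : Matrix (Fin n) (Fin n) ℂ) : (tP[n, q, μ, M]).totalDegree ≤ q * n * d := by
  refine (MvPolynomial.totalDegree_finsetProd _ _).trans ?_
  calc ∑ j, ((leadMinor Fin.castSucc (genU[n] * cM[n, M]) j.succ) ^ (q * μ j)).totalDegree
      ≤ ∑ j, q * μ j * n := Finset.sum_le_sum fun j _ =>
        (MvPolynomial.totalDegree_pow _ _).trans
          (Nat.mul_le_mul_left _ (totalDegree_leadMinor_genU_mul_le M _))
    _ = q * n * ∑ j, μ j := by rw [Finset.mul_sum]; exact Finset.sum_congr rfl fun j _ => by ring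
    _ ≤ q * n * d := Nat.mul_le_mul_left _ hμ

/-- Evaluating the generic unitriangular matrix at the entries of an upper unitriangular `u` gives `u`. -/
private theorem genU_map_eval (u : Matrix (Fin n) (Fin n) ℂ) (hu : u.BlockTriangular Fin.castSucc)
    (hu1 : ∀ i, u i i = 1) :
    (genU[n]).map (MvPolynomial.eval fun s : SU[n] => u s.1.1 s.1.2) = u := by
  ext i j
  simp only [Matrix.map_apply, Matrix.of_apply]
  split_ifs with h h'
  · simp
  · subst h'; simp [hu1]
  · rw [map_zero]
    have hji : j < i := lt_of_le_of_ne (not_lt.mp h) (Ne.symm h')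
    exact (hu hji).symm

/-- Evaluating `P_M` at the entries of `u` gives `Π_j Δ_{j+1}(u M)^(q μ_j)`. -/
private theorem eval_testPoly (q : ℕ) (μ : Fin n → ℕ) (M u : Matrix (Fin n) (Fin n) ℂ)
    (hu : u.BlockTriangular Fin.castSucc) (hu1 : ∀ i, u i i = 1) :
    MvPolynomial.eval (fun s : SU[n] => u s.1.1 s.1.2) (tP[n, q, μ, M]) =
      ∏ j : Fin n, (leadMinor Fin.castSucc (u * M) j.succ) ^ (q * μ j) := by
  rw [map_prod]
  refine Finset.prod_congr rfl fun j _ => ?_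
  have hM : (cM[n, M]).map (MvPolynomial.eval fun s : SU[n] => u s.1.1 s.1.2) = M := by
    ext i k
    simp
  rw [map_pow, ← leadMinor_map, Matrix.map_mul, genU_map_eval u hu hu1, hM]

/-- `toF[β] s = β s`. -/
private theorem toF_apply {K : ℕ} (β : SU[n] → Fin (K + 1)) (s : SU[n]) :
    (toF[β]) s = (β s : ℕ) := by
  simp

/-- `β ↦ toF[β]` is injective. -/
private theorem toF_injective (K : ℕ) :
    Function.Injective fun β : SU[n] → Fin (K + 1) => (toF[β] : SU[n] →₀ ℕ) := by
  intro β β' h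
  funext s
  apply Fin.ext
  have := congrArg (fun f : SU[n] →₀ ℕ => f s) h
  simpa using this

/-- The support of a polynomial of total degree `≤ K` consists of exponent vectors bounded by `K`. -/
private theorem support_subset_image_toF {K : ℕ} (P : MvPolynomial SU[n] ℂ)
    (hP : P.totalDegree ≤ K) :
    P.support ⊆ Finset.univ.image fun β : SU[n] → Fin (K + 1) => (toF[β] : SU[n] →₀ ℕ) := by
  intro dd hdd
  have hle : ∀ s, dd s ≤ K := fun s =>
    ((Finsupp.le_degree s dd).trans (MvPolynomial.le_totalDegree hdd)).trans hP
  refine Finset.mem_image.mpr ⟨fun s => ⟨dd s, Nat.lt_succ_of_le (hle s)⟩, Finset.mem_univ _, ?_⟩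
  ext s
  simp

/-- **Stub H4 (lead).** Unipotent translates of a flag-minor monomial of weight `≤ d` (raised to `q`)
lie in the span of `≤ (qnd+1)^(n(n-1)/2)` coefficient functions: there are functions
`G β : Matrix → ℂ`, `β : (strictly upper positions) → Fin (qnd+1)`, such that for every upper
unitriangular `u` one has `Π_j Δ_{j+1}(u M)^(q μ_j) = Σ_β c_β(u) G β M` for all `M`, with
`c_β(u) = Π_s u_s^(β s)`. -/
theorem stub_unipotent_translate_span {n : ℕ} (q d : ℕ) (μ : Fin n → ℕ) (hμ : ∑ j, μ j ≤ d) :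
    ∃ G : ({p : Fin n × Fin n // p.1 < p.2} → Fin (q * n * d + 1)) → Matrix (Fin n) (Fin n) ℂ → ℂ,
      ∀ u : Matrix (Fin n) (Fin n) ℂ, u.BlockTriangular Fin.castSucc → (∀ i, u i i = 1) →
        ∃ c : ({p : Fin n × Fin n // p.1 < p.2} → Fin (q * n * d + 1)) → ℂ,
          ∀ M : Matrix (Fin n) (Fin n) ℂ,
            (∏ j : Fin n, (Literature.NumberTheory.Automorphic.leadMinor Fin.castSucc (u * M) j.succ) ^ (q * μ j))
              = ∑ β, c β * G β M := by
  refine ⟨fun β M => MvPolynomial.coeff (toF[β]) (tP[n, q, μ, M]), fun u hu hu1 => ?_⟩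
  refine ⟨fun β => ∏ s : SU[n], (u s.1.1 s.1.2) ^ (β s : ℕ), fun M => ?_⟩
  rw [← eval_testPoly q μ M u hu hu1, MvPolynomial.eval_eq']
  have hsub := support_subset_image_toF (tP[n, q, μ, M]) (totalDegree_testPoly_le q d μ hμ M)
  rw [Finset.sum_subset hsub, Finset.sum_image fun β _ β' _ h => toF_injective _ h]
  · refine Finset.sum_congr rfl fun β _ => ?_
    rw [mul_comm]
    congr 1
  · intro dd _ hdd
    simp [MvPolynomial.notMem_support_iff.mp hdd]

end UnipotentSpan

end Summit.MatrixMultiplication.MatrixMultiplication.Theorems.BorderHalfDimensionDesigns
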